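import Summits.BirchSwinnertonDyer.BirchSwinnertonDyer.Theorems.ClassRecordThreeEulerHalvesAtThreeCartanCoverHeckeDatumCover
import Literature.NumberTheory.Automorphic.ShimuraCurveCartanLevelCommonReduction
import HarnessLib

/-!
# (SIMREP) `InertHecke.SimultaneousHeckeReps` is a THEOREM — crux `CartanOnePlaceDegreeLawAtThree` (stmt-BirchSwinnertonDyer-24801), lines `lattice` ∕ `charext`, Galois leaf (OBS)

The print input (SIMREP) «simultaneous Hecke representatives at a good prime» of the inert-Hecke certificate
(`…CartanCoverHeckeDatumCover`, p740670, `@[conjecture] def InertHecke.SimultaneousHeckeReps`) is DISCHARGED from tree bricks only: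

* common reduction modulo `q O₀` of two elements of `O` of the same prime norm up to `O¹`
  (Literature `CartanLevelCurveData.exists_normOne_mul_sub_eq_smul_hull`, `ShimuraCurveCartanLevelCommonReduction.lean`: strong approximation
  for the Cartan order at `q` in residue form, `O¹ ↠ 𝔽_{q²}¹`) — the representatives `α_i = g_i · q_i.out` are arranged to have ONE reduction mod `q O₀`;
* (iv) covering: the hull unit of `exists_normOne_mul_mem` (Eichler–Kneser for `O₀¹` with Cartan congruences, `ShimuraCurveCartanLevelHeckeCosets.lean`)
  lies in the cover order `O₀' = O + n_q O₀` (`mem_of_smul_mem_of_mul_mem_of_reducedNorm`: `ℓ u = (u x₀) x̄₀ ∈ O₀'`, `n_q u ∈ O₀'`, Bézout);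
* (i) inequivalence: `mem_Gamma_of_mul_mem_heckeSet` (a hull unit matching two elements of `ι(O(ℓ))` lies in `Γ`); (ii) stability ⟸ (iv);
* (iii) the two-sided test for `Γ̄(q)`: `exists_sub_one_eq_smul_of_mul_eq_mul` (`ℓ d = α_i β ᾱ_j ≡ ℓ (mod q O₀)`, Bézout twice).

Filed by bsd-stepL `defn-ty1` g42 (TYPED AND PROVED; Theorems is prover-landed). Consequence for the certificate: the `HeckeDatum.ofStable` datum on
`coverUnits X q` built from these representatives IS `T_ℓ` of the cover and agrees with `T_ℓ` of `X.Gamma` on `Γ̄(q)` (T11c' `cover_op_eq_on_principalLevel`).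
Nothing is asserted about any curve; BSD is proved for no curve. [cite: ShimuraIATAF1971, Prop. 3.36 and §3.3] [cite: VignerasLNM800, Ch. III §4 Thm. 4.3 and §5]
-/

set_option linter.dupNamespace false
set_option autoImplicit false

noncomputable section

open scoped Classical MatrixGroups

namespace Summit.BirchSwinnertonDyer.BirchSwinnertonDyer.Theorems.CartanCover.Charext.InertHecke

open Summit.BirchSwinnertonDyer.BirchSwinnertonDyer.Theorems Literature.NumberTheory.Automorphic

variable {D M : ℕ} {C : Finset ℕ}

/-- `ι(O₀'¹) ≤ ι(O₀¹)` (the cover order lies in the hull). -/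
private theorem coverUnits_le_hull (X : CartanLevelCurveData D M C) (q : ℕ) :
    CartanCover.coverUnits X q ≤ normOneUnits X.ι X.isEichlerOrder.isOrder := by
  rintro g ⟨⟨x, hx, hxg⟩, ⟨y, hy, hyg⟩, hdet⟩
  exact ⟨⟨x, CartanCover.coverOrder_le X q hx, hxg⟩, ⟨y, CartanCover.coverOrder_le X q hy, hyg⟩, hdet⟩

/-- Bézout in a `ℤ`-module: `m • u ∈ P`, `n • u ∈ P`, `gcd(m, n) = 1` give `u ∈ P`. -/
private theorem mem_of_coprime_smul_mem {V : Type*} [AddCommGroup V] {P : Submodule ℤ V} {u : V} {m n : ℕ}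
    (hmn : m.Coprime n) (hm : (m : ℤ) • u ∈ P) (hn : (n : ℤ) • u ∈ P) : u ∈ P := by
  obtain ⟨s, t, hst⟩ := Nat.isCoprime_iff_coprime.mpr hmn
  have e : u = s • ((m : ℤ) • u) + t • ((n : ℤ) • u) := by
    rw [smul_smul, smul_smul, ← add_smul, hst, one_smul]
  rw [e]
  exact P.add_mem (P.smul_mem s hm) (P.smul_mem t hn)

/-- The cover index `n_q = ∏_{C ∖ q} p` is prime to `q` (for `q ∈ C`, all members of `C` prime). -/
private theorem coprime_coverIndex (X : CartanLevelCurveData D M C) {q : ℕ} (hq : q ∈ C) :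
    q.Coprime (CartanCover.coverIndex C q) := by
  unfold CartanCover.coverIndex
  exact Nat.Coprime.prod_right fun p hp =>
    (Nat.coprime_primes (X.coprime q hq).1 (X.coprime p (Finset.mem_of_mem_erase hp)).1).mpr
      (Finset.ne_of_mem_erase hp).symm

/-- A prime `ℓ` different from every member of `C` is prime to `n_q`. -/
private theorem coprime_coverIndex_of_forall_ne (X : CartanLevelCurveData D M C) (q : ℕ) {ℓ : ℕ} (hℓ : ℓ.Prime)
    (hCℓ : ∀ p ∈ C, p ≠ ℓ) : ℓ.Coprime (CartanCover.coverIndex C q) := by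
  unfold CartanCover.coverIndex
  exact Nat.Coprime.prod_right fun p hp =>
    (Nat.coprime_primes hℓ (X.coprime p (Finset.mem_of_mem_erase hp)).1).mpr
      (hCℓ p (Finset.mem_of_mem_erase hp)).symm

/-- **(SIMREP) PROVED: simultaneous Hecke representatives at a good prime.** For `q ∈ C` and a prime `ℓ ∤ q·D·M·∏_C p` there are
`g_i ∈ Γ = ι(O¹)` such that the translates `α_i = g_i · q_i.out` of the tree's representatives of `Γ∖ι(O(ℓ))` are pairwise
`ι(O₀'¹)`-inequivalent, right-`ι(O₀'¹)`-stable, pass the two-sided test for `Γ̄(q)`, and represent every `ι(O₀'¹)`-coset of `ι(O₀'(ℓ))`.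
Proof: choose `g_i` (strong approximation for `O` at `q`, residue form) so that all `α_i` have ONE reduction modulo `q O₀`.
[cite: ShimuraIATAF1971, Prop. 3.36 and §3.3] [cite: VignerasLNM800, Ch. III §4 Thm. 4.3 and §5] -/
theorem simultaneousHeckeReps_holds : SimultaneousHeckeReps := by
  intro D M C X q _ hq ℓ hℓ hℓdvd
  classical
  -- orders and coprimality bookkeeping
  have hO₀ : Brandt.IsOrder X.B X.O₀ := X.isEichlerOrder.isOrder
  have hO' : Brandt.IsOrder X.B (CartanCover.coverOrder X q) := CartanCover.isOrder_coverOrder X q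
  have hqp : q.Prime := (X.coprime q hq).1
  have hCℓ : ∀ p ∈ C, p ≠ ℓ := by
    rintro p hp rfl
    exact hℓdvd (Dvd.dvd.mul_left (Dvd.dvd.mul_left (Finset.dvd_prod_of_mem (fun p => p) hp) (D * M)) q)
  have hqℓ : q ≠ ℓ := hCℓ q hq
  have hℓq : ℓ.Coprime q := (Nat.coprime_primes hℓ hqp).mpr (Ne.symm hqℓ)
  have hℓn : ℓ.Coprime (CartanCover.coverIndex C q) := coprime_coverIndex_of_forall_ne X q hℓ hCℓ
  have hqn : q.Coprime (CartanCover.coverIndex C q) := coprime_coverIndex X hq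
  have hsq : ∀ p ∈ C, ¬ (p : ℤ) ^ 2 ∣ (ℓ : ℤ) := by
    intro p hp hdvd
    have hpp : p.Prime := (X.coprime p hp).1
    have h1 : (p : ℤ) ∣ (ℓ : ℤ) := (dvd_pow_self (p : ℤ) two_ne_zero).trans hdvd
    have h2 : p ∣ ℓ := by exact_mod_cast h1
    exact hCℓ p hp ((Nat.prime_dvd_prime_iff_eq hpp hℓ).mp h2)
  -- Step 1 (covering, first half): every `a ∈ ι(O₀'(ℓ))` has a left `ι(O₀'¹)`-translate in `ι(O(ℓ))`
  have step1 : ∀ a ∈ unitsHeckeSet X.ι (O := CartanCover.coverOrder X q) ℓ,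
      ∃ v ∈ CartanCover.coverUnits X q, v * a ∈ X.heckeSet ℓ := by
    rintro a ⟨⟨x₀, hx₀, hx₀a⟩, hdet⟩
    have hn₀ : reducedNorm ℚ X.B x₀ = ℓ := reducedNorm_eq_natCast_of_det_eq X.ι hx₀a hdet
    obtain ⟨v, hv₀, hvn, hvx⟩ := X.exists_normOne_mul_mem hℓ hCℓ (CartanCover.coverOrder_le X q hx₀) hn₀
    have hvO' : v ∈ CartanCover.coverOrder X q :=
      mem_of_smul_mem_of_mul_mem_of_reducedNorm hO' hℓn (CartanCover.smul_mem_coverOrder X q hv₀) hx₀ hn₀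
        (CartanCover.le_coverOrder X q hvx)
    obtain ⟨γ, hγ, hγv⟩ := exists_mem_normOneUnits_coe_eq X.ι hO' hvO' hvn
    refine ⟨γ, hγ, ⟨v * x₀, hvx, by rw [map_mul, ← hγv, hx₀a, Units.val_mul]⟩, ?_⟩
    rw [Units.val_mul, Matrix.det_mul, ← Matrix.GeneralLinearGroup.val_det_apply, hγ.2.2, Units.val_one, one_mul, hdet]
  -- the tree's representatives and their lifts
  have hr : ∀ i : Quotient (X.heckeSetoid ℓ), ∃ x ∈ X.O,
      X.ι x = (((i.out : X.heckeSet ℓ) : GL (Fin 2) ℝ) : Matrix (Fin 2) (Fin 2) ℝ) ∧ reducedNorm ℚ X.B x = ℓ := by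
    intro i
    obtain ⟨⟨x, hx, hxr⟩, hdet⟩ := (i.out : X.heckeSet ℓ).2
    exact ⟨x, hx, hxr, reducedNorm_eq_natCast_of_det_eq X.ι hxr hdet⟩
  choose x hxO hxι hxn using hr
  by_cases hI : Nonempty (Quotient (X.heckeSetoid ℓ))
  swap
  · -- no cosets: everything is vacuous, and (iv) would produce a coset
    refine ⟨fun _ => 1, fun _ => one_mem _, fun i => (hI ⟨i⟩).elim, fun _ _ i => (hI ⟨i⟩).elim,
      fun _ _ i => (hI ⟨i⟩).elim, fun a ha => ?_⟩
    obtain ⟨v, -, hva⟩ := step1 a ha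
    exact (hI ⟨Quotient.mk _ ⟨v * a, hva⟩⟩).elim
  obtain ⟨i₀⟩ := hI
  -- common reduction: `u_i x_i ≡ x_{i₀} (mod q O₀)` with `u_i ∈ O¹`
  have hu : ∀ i : Quotient (X.heckeSetoid ℓ), ∃ u ∈ X.O, reducedNorm ℚ X.B u = 1 ∧
      ∃ w ∈ X.O₀, u * x i - x i₀ = (q : ℤ) • w := fun i =>
    X.exists_normOne_mul_sub_eq_smul_hull hq hℓ (hxO i) (hxO i₀) (hxn i) (hxn i₀)
  choose u huO hun w hwO huw using hu
  have hg : ∀ i : Quotient (X.heckeSetoid ℓ), ∃ γ ∈ X.Gamma, ((γ : GL (Fin 2) ℝ) : Matrix (Fin 2) (Fin 2) ℝ) = X.ι (u i) :=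
    fun i => exists_mem_normOneUnits_coe_eq X.ι X.isOrder (huO i) (hun i)
  choose g hgΓ hgι using hg
  -- the new representatives `α_i = g_i · r_i = ι(u_i x_i)`
  have hα : ∀ i : Quotient (X.heckeSetoid ℓ),
      X.ι (u i * x i) = ((g i * ((i.out : X.heckeSet ℓ) : GL (Fin 2) ℝ) : GL (Fin 2) ℝ) : Matrix (Fin 2) (Fin 2) ℝ) := fun i => by
    rw [map_mul, ← hgι, hxι, Units.val_mul]
  have hαO : ∀ i, u i * x i ∈ X.O := fun i => X.isOrder.mul_mem _ (huO i) _ (hxO i)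
  have hαn : ∀ i, reducedNorm ℚ X.B (u i * x i) = ℓ := fun i => by
    rw [reducedNorm_mul_holds ℚ X.B, hun, hxn, one_mul]
  have hαdet : ∀ i : Quotient (X.heckeSetoid ℓ),
      ((g i * ((i.out : X.heckeSet ℓ) : GL (Fin 2) ℝ) : GL (Fin 2) ℝ) : Matrix (Fin 2) (Fin 2) ℝ).det = ℓ := fun i => by
    rw [Units.val_mul, Matrix.det_mul, ← Matrix.GeneralLinearGroup.val_det_apply, (hgΓ i).2.2, Units.val_one, one_mul,
      (i.out : X.heckeSet ℓ).2.2]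
  have hαmem' : ∀ i : Quotient (X.heckeSetoid ℓ),
      g i * ((i.out : X.heckeSet ℓ) : GL (Fin 2) ℝ) ∈ unitsHeckeSet X.ι (O := CartanCover.coverOrder X q) ℓ := fun i =>
    ⟨⟨u i * x i, CartanCover.le_coverOrder X q (hαO i), hα i⟩, hαdet i⟩
  have hαmem : ∀ i : Quotient (X.heckeSetoid ℓ), g i * ((i.out : X.heckeSet ℓ) : GL (Fin 2) ℝ) ∈ X.heckeSet ℓ := fun i =>
    ⟨⟨u i * x i, hαO i, hα i⟩, hαdet i⟩
  -- (iv) covering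
  have cover : ∀ a ∈ unitsHeckeSet X.ι (O := CartanCover.coverOrder X q) ℓ, ∃ (i : Quotient (X.heckeSetoid ℓ)),
      ∃ v ∈ CartanCover.coverUnits X q, v * a = g i * ((i.out : X.heckeSet ℓ) : GL (Fin 2) ℝ) := by
    intro a ha
    obtain ⟨v, hv, hva⟩ := step1 a ha
    set i : Quotient (X.heckeSetoid ℓ) := Quotient.mk _ ⟨v * a, hva⟩ with hi
    obtain ⟨γ, hγ, hγe⟩ : (X.heckeSetoid ℓ) ⟨v * a, hva⟩ i.out := Quotient.exact (by rw [Quotient.out_eq])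
    change γ * (v * a) = ((i.out : X.heckeSet ℓ) : GL (Fin 2) ℝ) at hγe
    refine ⟨i, g i * γ * v, mul_mem (mul_mem (CartanCover.Gamma_le_coverUnits X q (hgΓ i)) (CartanCover.Gamma_le_coverUnits X q hγ)) hv, ?_⟩
    rw [← hγe, mul_assoc, mul_assoc]
  refine ⟨g, hgΓ, ?_, ?_, ?_, cover⟩
  · -- (i) pairwise `ι(O₀'¹)`-inequivalence
    intro i j v hv hij
    set γ₀ : GL (Fin 2) ℝ := (g i)⁻¹ * v * g j with hγ₀
    have h1 : γ₀ * ((j.out : X.heckeSet ℓ) : GL (Fin 2) ℝ) = ((i.out : X.heckeSet ℓ) : GL (Fin 2) ℝ) := by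
      rw [hγ₀, mul_assoc, mul_assoc, ← hij, inv_mul_cancel_left]
    have hγ₀h : γ₀ ∈ normOneUnits X.ι X.isEichlerOrder.isOrder :=
      mul_mem (mul_mem (inv_mem (X.gamma_le_normOneUnits_hull (hgΓ i))) (coverUnits_le_hull X q hv))
        (X.gamma_le_normOneUnits_hull (hgΓ j))
    have hγ₀Γ : γ₀ ∈ X.Gamma :=
      X.mem_Gamma_of_mul_mem_heckeSet hsq hγ₀h (j.out : X.heckeSet ℓ).2 (i.out : X.heckeSet ℓ).2 h1
    have hji : (Quotient.mk (X.heckeSetoid ℓ) (j.out : X.heckeSet ℓ)) = Quotient.mk (X.heckeSetoid ℓ) (i.out : X.heckeSet ℓ) :=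
      Quotient.sound ⟨γ₀, hγ₀Γ, h1⟩
    rw [Quotient.out_eq, Quotient.out_eq] at hji
    exact hji.symm
  · -- (ii) right `ι(O₀'¹)`-stability (from (iv))
    intro v hv i
    obtain ⟨j, v', hv', hv'e⟩ := cover _ (unitsHeckeSet_mul_mem X.ι hO' (hαmem' i) hv)
    refine ⟨j, ?_⟩
    rw [← hv'e, mul_inv_rev, ← mul_assoc, mul_inv_cancel, one_mul]
    exact inv_mem hv'
  · -- (iii) the two-sided test for `Γ̄(q)`
    intro β hβ i j hδ
    obtain ⟨⟨d, hdO, hdι⟩, -, -⟩ := id hδ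
    obtain ⟨-, b, hb, hbι, y, hy, hby⟩ := id hβ
    have key : d * (u j * x j) = u i * x i * b := X.ι_injective (by
      rw [map_mul X.ι d (u j * x j), hα j, map_mul X.ι (u i * x i) b, hα i, hdι, hbι, ← Units.val_mul, ← Units.val_mul,
        inv_mul_cancel_right])
    obtain ⟨y₁, hy₁, hdy₁⟩ := exists_sub_one_eq_smul_of_mul_eq_mul hO₀ hℓq (X.le (hαO j)) (X.le hdO) (hαn j)
      ⟨w i - w j, X.O₀.sub_mem (hwO i) (hwO j), by rw [smul_sub, ← huw i, ← huw j]; abel⟩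
      ⟨y, CartanCover.coverOrder_le X q hy, hby⟩ key
    have hy₁O' : y₁ ∈ CartanCover.coverOrder X q := by
      refine mem_of_coprime_smul_mem hqn ?_ (CartanCover.smul_mem_coverOrder X q hy₁)
      rw [← hdy₁]
      exact (CartanCover.coverOrder X q).sub_mem (CartanCover.le_coverOrder X q hdO) hO'.one_mem
    exact ⟨CartanCover.Gamma_le_coverUnits X q hδ, d, CartanCover.le_coverOrder X q hdO, hdι, y₁, hy₁O', hdy₁⟩

end Summit.BirchSwinnertonDyer.BirchSwinnertonDyer.Theorems.CartanCover.Charext.InertHecke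

end
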